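import Mathlib
import Summits.Ventures.PercRepro2.Defs
import Summits.Ventures.PercRepro2.Independence
import Summits.Ventures.PercRepro2.Harris
import Summits.Ventures.PercRepro2.Graph
import Summits.Ventures.PercRepro2.Exploration
import Summits.Ventures.PercRepro2.ObsIndependence
import Summits.Ventures.PercRepro2.Events
import Summits.Ventures.PercRepro2.BasePrime
import Summits.Ventures.PercRepro2.BasePendant

/-!
# (BASE) at a pendant `h` (blind cell PercRepro2, p1; `proofs/P1-TWOCOPY.md` §9)

The mirror of `basePendant`: if the root `h` is a leaf with only edge `f = {h, w}`, the
2-colouring base holds. Pinning `f`: when `f` is red, `h` is blue-isolated, so the blue side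
vanishes and the red side is a (BASE′)-type event at `w`; when `f` is blue, `h` is red-isolated, so
the red side vanishes and the blue side is the flipped image of the same event with the roles of
`(l, o)` and `(w, b)` exchanged — `basePrime ends w l b o` after the flip symmetry.
-/

namespace Summit.Ventures.PercRepro2

section PendantH

variable {V : Type*} {E : Type*} [Fintype E] [DecidableEq E] [Fintype V] [DecidableEq V]
  {R : Type*} [Field R] [LinearOrder R] [IsStrictOrderedRing R]

omit [Fintype E] [Fintype V] [DecidableEq V] [Field R] [LinearOrder R] [IsStrictOrderedRing R] in
/-- Flipping after pinning an edge closed is pinning it open after flipping. -/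
lemma flipAll_update_false (ω : Config E) (f : E) :
    flipAll (Function.update ω f false) = Function.update (flipAll ω) f true := by
  funext e
  by_cases hef : e = f
  · subst hef; simp [flipAll]
  · simp [flipAll, Function.update_of_ne hef]

omit [Fintype E] [DecidableEq E] [Fintype V] [DecidableEq V] [Field R] [LinearOrder R]
  [IsStrictOrderedRing R] in
/-- `flipAll` is an involution (preimage form). -/
lemma flipAll_preimage_flipAll_preimage (A : Set (Config E)) :
    flipAll ⁻¹' (flipAll ⁻¹' A) = A := by
  ext ω
  simp [flipAll_involutive ω]

/-- **(BASE) at a pendant `h`**: if `h` is a leaf (its only edge is `f = {h, w}`), then under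
uniform 2-colourings
`P(l ↮_R h, l ↮_B h, o ↔_R l, b ↔_R h) ≤ P(l ↮_R h, l ↮_B h, o ↔_R l, b ↔_B h)`. -/
theorem basePendantH (ends : E → Sym2 V) {h w : V} {f : E} (hf : ends f = s(h, w))
    (hleaf : ∀ e, h ∈ ends e → e = f) (hhw : h ≠ w) {l o b : V} (hl : l ≠ h) (ho : o ≠ h)
    (hb : b ≠ h) :
    prob (half (E := E) (R := R)) ((connEvent ends l h)ᶜ ∩ flipAll ⁻¹' (connEvent ends l h)ᶜ ∩
        connEvent ends l o ∩ connEvent ends h b) ≤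
      prob (half (E := E) (R := R)) ((connEvent ends l h)ᶜ ∩ flipAll ⁻¹' (connEvent ends l h)ᶜ ∩
        connEvent ends l o ∩ flipAll ⁻¹' connEvent ends h b) := by
  -- pin the pendant edge in both probabilities
  have pin : ∀ A : Set (Config E), prob (half (E := E) (R := R)) A =
      (1 / 2 : R) * prob half ((fun ω : Config E => Function.update ω f true) ⁻¹' A) +
        (1 / 2 : R) * prob half ((fun ω : Config E => Function.update ω f false) ⁻¹' A) := by
    intro A
    rw [prob_eq_pin half A f]
    rw [prob_eq_expect_indicator (Function.update half f 1), expect_update_one,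
      ← prob_preimage_eq_expect, prob_eq_expect_indicator (Function.update half f 0),
      expect_update_zero, ← prob_preimage_eq_expect]
    have h12 : (1 - 1 / 2 : R) = 1 / 2 := by norm_num
    simp only [half, h12]
  -- red side: `f` open gives the event at `w`; `f` closed kills `b ↔_R h`
  have hR1 : (fun ω : Config E => Function.update ω f true) ⁻¹'
      ((connEvent ends l h)ᶜ ∩ flipAll ⁻¹' (connEvent ends l h)ᶜ ∩ connEvent ends l o ∩
        connEvent ends h b) =
      (connEvent ends l w)ᶜ ∩ connEvent ends l o ∩ connEvent ends w b := by
    ext ω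
    simp only [Set.mem_preimage, Set.mem_inter_iff, Set.mem_compl_iff, mem_connEvent]
    have hopen : Function.update ω f true f = true := by simp
    have hlh : Conn ends (Function.update ω f true) l h ↔ Conn ends ω l w := by
      constructor
      · intro hc
        have := (conn_leaf_open hf hopen).1 (conn_symm hc)
        exact conn_symm ((conn_update_leaf_iff hf hleaf hhw true (Ne.symm hhw) hl).1 this)
      · intro hc
        exact conn_symm ((conn_leaf_open hf hopen).2
          ((conn_update_leaf_iff hf hleaf hhw true (Ne.symm hhw) hl).2 (conn_symm hc)))
    have hlo : Conn ends (Function.update ω f true) l o ↔ Conn ends ω l o :=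
      conn_update_leaf_iff hf hleaf hhw true hl ho
    have hhb : Conn ends (Function.update ω f true) h b ↔ Conn ends ω w b := by
      rw [conn_leaf_open hf hopen]
      exact conn_update_leaf_iff hf hleaf hhw true (Ne.symm hhw) hb
    have hblue : ¬ Conn ends (flipAll (Function.update ω f true)) l h := by
      rw [flipAll_update_true]
      intro hc
      exact hl (conn_leaf_closed hf hleaf hhw (by simp) (conn_symm hc))
    rw [hlh, hlo, hhb]
    tauto
  have hR0 : (fun ω : Config E => Function.update ω f false) ⁻¹'
      ((connEvent ends l h)ᶜ ∩ flipAll ⁻¹' (connEvent ends l h)ᶜ ∩ connEvent ends l o ∩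
        connEvent ends h b) = ∅ := by
    ext ω
    simp only [Set.mem_preimage, Set.mem_inter_iff, Set.mem_compl_iff, mem_connEvent,
      Set.mem_empty_iff_false, iff_false]
    intro hm
    exact hb (conn_leaf_closed hf hleaf hhw (by simp) hm.2)
  -- blue side: `f` open kills `b ↔_B h`; `f` closed gives the flipped event at `w`
  have hB1 : (fun ω : Config E => Function.update ω f true) ⁻¹'
      ((connEvent ends l h)ᶜ ∩ flipAll ⁻¹' (connEvent ends l h)ᶜ ∩ connEvent ends l o ∩
        flipAll ⁻¹' connEvent ends h b) = ∅ := by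
    ext ω
    simp only [Set.mem_preimage, Set.mem_inter_iff, Set.mem_compl_iff, mem_connEvent,
      Set.mem_empty_iff_false, iff_false]
    intro hm
    have hc := hm.2
    rw [flipAll_update_true] at hc
    exact hb (conn_leaf_closed hf hleaf hhw (by simp) hc)
  have hB0 : (fun ω : Config E => Function.update ω f false) ⁻¹'
      ((connEvent ends l h)ᶜ ∩ flipAll ⁻¹' (connEvent ends l h)ᶜ ∩ connEvent ends l o ∩
        flipAll ⁻¹' connEvent ends h b) =
      flipAll ⁻¹' ((connEvent ends l w)ᶜ ∩ flipAll ⁻¹' connEvent ends l o ∩ connEvent ends w b) := by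
    ext ω
    simp only [Set.mem_preimage, Set.mem_inter_iff, Set.mem_compl_iff, mem_connEvent,
      flipAll_involutive ω]
    have hopen : Function.update (flipAll ω) f true f = true := by simp
    have hlh : Conn ends (flipAll (Function.update ω f false)) l h ↔ Conn ends (flipAll ω) l w := by
      rw [flipAll_update_false]
      constructor
      · intro hc
        have := (conn_leaf_open hf hopen).1 (conn_symm hc)
        exact conn_symm ((conn_update_leaf_iff hf hleaf hhw true (Ne.symm hhw) hl).1 this)
      · intro hc
        exact conn_symm ((conn_leaf_open hf hopen).2
          ((conn_update_leaf_iff hf hleaf hhw true (Ne.symm hhw) hl).2 (conn_symm hc)))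
    have hlo : Conn ends (Function.update ω f false) l o ↔ Conn ends ω l o :=
      conn_update_leaf_iff hf hleaf hhw false hl ho
    have hhb : Conn ends (flipAll (Function.update ω f false)) h b ↔ Conn ends (flipAll ω) w b := by
      rw [flipAll_update_false, conn_leaf_open hf hopen]
      exact conn_update_leaf_iff hf hleaf hhw true (Ne.symm hhw) hb
    have hred : ¬ Conn ends (Function.update ω f false) l h := by
      intro hc
      exact hl (conn_leaf_closed hf hleaf hhw (by simp) (conn_symm hc))
    rw [hlh, hlo, hhb]
    tauto
  have pR := pin ((connEvent ends l h)ᶜ ∩ flipAll ⁻¹' (connEvent ends l h)ᶜ ∩ connEvent ends l o ∩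
    connEvent ends h b)
  have pB := pin ((connEvent ends l h)ᶜ ∩ flipAll ⁻¹' (connEvent ends l h)ᶜ ∩ connEvent ends l o ∩
    flipAll ⁻¹' connEvent ends h b)
  rw [pR, pB, hR1, hR0, hB1, hB0, prob_half_flipAll, prob_empty]
  simp only [mul_zero, add_zero, zero_add]
  refine mul_le_mul_of_nonneg_left ?_ (by norm_num)
  -- (BASE′) with the roles `(l, o) ↔ (w, b)` exchanged
  have key := basePrime (R := R) ends w l b o
  have e1 : (connEvent ends w l)ᶜ ∩ connEvent ends w b ∩ connEvent ends l o =
      (connEvent ends l w)ᶜ ∩ connEvent ends l o ∩ connEvent ends w b := by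
    rw [connEvent_comm ends w l]
    ext ω; simp only [Set.mem_inter_iff]; tauto
  have e2 : (connEvent ends w l)ᶜ ∩ connEvent ends w b ∩ flipAll ⁻¹' connEvent ends l o =
      (connEvent ends l w)ᶜ ∩ flipAll ⁻¹' connEvent ends l o ∩ connEvent ends w b := by
    rw [connEvent_comm ends w l]
    ext ω; simp only [Set.mem_inter_iff]; tauto
  rw [e1, e2] at key
  exact key

end PendantH

end Summit.Ventures.PercRepro2
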